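import Literature.Probability.Percolation.ConditionalPositiveAssociationProofs
import HarnessLib

/-!
# `NoHeavyLowerTail` (crux stmt-CriticalPhenomena-4575), law-level frontier: van den Berg–Häggström–Kahn's Theorem 1.1
# with the source replaced by a SET of terminals (finite-sum form, second factor the bare separation event)

Support file (prover seat `prim-bnk-1` gen 14; `--supports stmt-CriticalPhenomena-4575`; no computation, no new definition).

BHK (2006), Thm. 1.1, is proved in the tree for a single source `s` as `BHK2006.core`
(`ConditionalPositiveAssociationProofs.lean`): `E[F(C_s) 1{s↮X}] · E[G(C_s) 1{s↮Y}] ≤ E[F G(C_s) 1{s↮X∩Y}] · P(s↮X∪Y)`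
for increasing `F, G ≥ 0`, percolation restricted to a vertex set `U`.  BHK's Remark 1 (after Thm. 1.2) replaces `s` by a
set of vertices.  This file proves that set form, in the special case `G = 1` which is all the conditional Gladkov–Zimin
theorem of this seat needs (memo run/shared/lean/prim/prim-l12/FROM-prim-bnk-1-gen14-CONDITIONAL-GZ-PROVED.md §2, inputs
(B1), (B2)):

  `E[F(C_T) 1{T↮X}] · P(T↮Y) ≤ E[F(C_T) 1{T↮X∩Y}] · P(T↮X∪Y)`     (`coreSet`),

where `C_T = ⋃_{t ∈ T} C_t^U` is the union of the restricted clusters (`BHK2006.rC`) of the terminals and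
`{T ↮ X} = {ω | ∀ t ∈ T, ω ∈ rD U t X}`.  The proof re-runs BHK's induction on the vertex set (`BHK2006.core`) verbatim
with the source set: the set versions of the locality identity (6) (`step_sumSet`) and of `rC_restrict` are unions /
conjunctions over `t ∈ T` of the single-source lemmas of the tree.  No definition is introduced; `C_T` and `{T ↮ X}` are
spelled out.
-/

namespace Summit.CriticalPhenomena.PercolationContinuityZ3.Theorems.SetSourceBHK

open Finset Literature.Probability.Percolation Literature.Probability.Percolation.BHK2006
open Literature.Probability.Percolation.DecisionTree (ind ind_of_mem ind_of_not_mem ind_nonneg)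
open scoped Classical

variable {V : Type*}

/-! ## Set versions of the graph lemmas -/

/-- `C_T = ⋃_{t∈T} C_t^U` is increasing in the configuration. [this work] -/
theorem rCT_mono (U T : Finset V) : Monotone fun ω : Set (Sym2 V) => ⋃ t ∈ T, rC U t ω :=
  fun _ _ h => Set.iUnion₂_mono fun t _ => rC_mono U t h

/-- `{T ↮ X}` is a decreasing event. [this work] -/
theorem rDT_decreasing {U T : Finset V} {X : Set V} {ω ω' : Set (Sym2 V)} (h : ω ⊆ ω')
    (h' : ω' ∈ {ω | ∀ t ∈ T, ω ∈ rD U t X}) : ω ∈ {ω | ∀ t ∈ T, ω ∈ rD U t X} :=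
  fun t ht => rD_decreasing h (h' t ht)

/-- The indicator of `{T ↮ X}` is antitone in the configuration. [this work] -/
theorem ind_rDT_antitone (U T : Finset V) (X : Set V) :
    Antitone (ind {ω : Set (Sym2 V) | ∀ t ∈ T, ω ∈ rD U t X}) := by
  intro ω ω' h
  by_cases h' : ω' ∈ {ω : Set (Sym2 V) | ∀ t ∈ T, ω ∈ rD U t X}
  · rw [ind_of_mem h', ind_of_mem (rDT_decreasing h h')]
  · rw [ind_of_not_mem h']; exact ind_nonneg _ _

/-- `{T ↮ X}` is antitone in `X`. [this work] -/
theorem rDT_antitone (U T : Finset V) {X X' : Set V} (h : X ⊆ X') :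
    {ω : Set (Sym2 V) | ∀ t ∈ T, ω ∈ rD U t X'} ⊆ {ω | ∀ t ∈ T, ω ∈ rD U t X} :=
  fun _ hω t ht => rD_antitone h (hω t ht)

/-- `{T ↮ X ∪ Y} = {T ↮ X} ∩ {T ↮ Y}`. [this work] -/
theorem rDT_union (U T : Finset V) (X Y : Set V) :
    {ω : Set (Sym2 V) | ∀ t ∈ T, ω ∈ rD U t (X ∪ Y)} =
      {ω | ∀ t ∈ T, ω ∈ rD U t X} ∩ {ω | ∀ t ∈ T, ω ∈ rD U t Y} := by
  ext ω
  simp only [Set.mem_setOf_eq, Set.mem_inter_iff, rD_union]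
  exact ⟨fun h => ⟨fun t ht => (h t ht).1, fun t ht => (h t ht).2⟩,
    fun h t ht => ⟨h.1 t ht, h.2 t ht⟩⟩

/-- `{T ↮ X} = ∅` when a terminal lies in `X`. [this work] -/
theorem rDT_eq_empty {U T : Finset V} {X : Set V} {t : V} (htT : t ∈ T) (htX : t ∈ X) :
    {ω : Set (Sym2 V) | ∀ t ∈ T, ω ∈ rD U t X} = ∅ :=
  Set.eq_empty_of_forall_notMem fun ω hω => by
    have := hω t htT
    rw [rD_eq_empty htX] at this
    exact this

variable [Fintype V]

/-- **Set form of BHK's identity (6), summed**: for `Z ⊆ W`, `Z ∩ T = ∅`,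
`E[H(C_T^U) 1{T ↮ W in G[U]}] = Σ_ζ weight(ζ) · E'[H(C_T^{U∖Z}) 1{T ↮ (W∖Z) ∪ S(ζ) in G[U∖Z]}]`, conditioning on the set
`S(ζ)` of vertices joined to `Z` by an open edge of `ζ`. [this work] -/
theorem step_sumSet {U Z T : Finset V} (hZU : Z ⊆ U) (hTZ : ∀ t ∈ T, t ∉ Z) {W : Set V}
    (hZW : (↑Z : Set V) ⊆ W) (w : Sym2 V → ℝ) (hm : ∑ ω, weight w ω = 1)
    (H : Set (Sym2 V) → ℝ) :
    ∑ ω, weight w ω * (H (⋃ t ∈ T, rC U t ω) * ind {ω | ∀ t ∈ T, ω ∈ rD U t W} ω) =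
      ∑ ζ, weight w ζ * ∑ ω, weight w ω * (H (⋃ t ∈ T, rC (U \ Z) t ω) *
        ind {ω | ∀ t ∈ T, ω ∈ rD (U \ Z) t ((W \ ↑Z) ∪ rS U Z ζ)} ω) := by
  set A := meeting Z with hA
  set Φ : Set (Sym2 V) → Set (Sym2 V) → ℝ := fun ζ η =>
    H (⋃ t ∈ T, rC (U \ Z) t η) * ind {ω | ∀ t ∈ T, ω ∈ rD (U \ Z) t ((W \ ↑Z) ∪ rS U Z ζ)} η with hΦ
  -- the restricted event and clusters do not see the edges meeting `Z`
  have hind : ∀ ζ ω : Set (Sym2 V),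
      ind {ω | ∀ t ∈ T, ω ∈ rD (U \ Z) t ((W \ ↑Z) ∪ rS U Z ζ)} (ω \ meeting Z) =
        ind {ω | ∀ t ∈ T, ω ∈ rD (U \ Z) t ((W \ ↑Z) ∪ rS U Z ζ)} ω := by
    intro ζ ω
    have hiff : (ω \ meeting Z ∈ {ω | ∀ t ∈ T, ω ∈ rD (U \ Z) t ((W \ ↑Z) ∪ rS U Z ζ)} ↔
        ω ∈ {ω | ∀ t ∈ T, ω ∈ rD (U \ Z) t ((W \ ↑Z) ∪ rS U Z ζ)}) := by
      simp only [Set.mem_setOf_eq, mem_rD_diff_meeting]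
    by_cases h : ω ∈ {ω | ∀ t ∈ T, ω ∈ rD (U \ Z) t ((W \ ↑Z) ∪ rS U Z ζ)}
    · rw [ind_of_mem h, ind_of_mem (hiff.2 h)]
    · rw [ind_of_not_mem h, ind_of_not_mem (fun h' => h (hiff.1 h'))]
  have hcl : ∀ ω : Set (Sym2 V), (⋃ t ∈ T, rC (U \ Z) t (ω \ meeting Z)) = ⋃ t ∈ T, rC (U \ Z) t ω :=
    fun ω => by simp only [rC_diff_meeting]
  have h1 : ∀ ω, H (⋃ t ∈ T, rC U t ω) * ind {ω | ∀ t ∈ T, ω ∈ rD U t W} ω = Φ (ω ∩ A) (ω \ A) := by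
    intro ω
    simp only [hΦ, hA]
    rw [rS_inter_meeting, hcl, hind]
    by_cases hω : ω ∈ {ω : Set (Sym2 V) | ∀ t ∈ T, ω ∈ rD U t W}
    · have hω' : ∀ t ∈ T, ω ∈ rD (U \ Z) t ((W \ ↑Z) ∪ rS U Z ω) := fun t ht =>
        (mem_rD_iff_restrict hZU (hTZ t ht) hZW ω).1 (hω t ht)
      have hωm : ω ∈ {ω' : Set (Sym2 V) | ∀ t ∈ T, ω' ∈ rD (U \ Z) t ((W \ ↑Z) ∪ rS U Z ω)} := hω'
      rw [ind_of_mem hω, ind_of_mem hωm]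
      congr 1
      refine congrArg H (Set.iUnion₂_congr fun t ht => ?_)
      exact rC_restrict (hTZ t ht) fun n hn => hω' t ht n (Or.inr hn)
    · have hω' : ω ∉ {ω' : Set (Sym2 V) | ∀ t ∈ T, ω' ∈ rD (U \ Z) t ((W \ ↑Z) ∪ rS U Z ω)} :=
        fun h => hω fun t ht => (mem_rD_iff_restrict hZU (hTZ t ht) hZW ω).2 (h t ht)
      rw [ind_of_not_mem hω, ind_of_not_mem hω', mul_zero, mul_zero]
  have h2 : ∀ ζ ω, Φ (ζ ∩ A) (ω \ A) =
      H (⋃ t ∈ T, rC (U \ Z) t ω) * ind {ω | ∀ t ∈ T, ω ∈ rD (U \ Z) t ((W \ ↑Z) ∪ rS U Z ζ)} ω := by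
    intro ζ ω
    simp only [hΦ, hA]
    rw [rS_inter_meeting, hcl, hind]
  calc ∑ ω, weight w ω * (H (⋃ t ∈ T, rC U t ω) * ind {ω | ∀ t ∈ T, ω ∈ rD U t W} ω)
      = (∑ ω, weight w ω) * ∑ ω, weight w ω * Φ (ω ∩ A) (ω \ A) := by
        rw [hm, one_mul]; simp_rw [h1]
    _ = ∑ ζ, weight w ζ * ∑ ω, weight w ω * Φ (ζ ∩ A) (ω \ A) := blockFubini w A Φ
    _ = _ := by simp_rw [h2]

/-- **BHK Theorem 1.1 with a source SET, functional form with `G = 1`, percolation restricted to `U`.**  For `T ⊆ U`,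
`X, Y ⊆ U`, `F ≥ 0` increasing:
`E[F(C_T) 1{T↮X}] · P(T↮Y) ≤ E[F(C_T) 1{T↮X∩Y}] · P(T↮X∪Y)`, where `C_T = ⋃_{t∈T} C_t^U`.
Strong induction on `U` following BHK pp. 3–5 / the tree's `BHK2006.core`. [this work] -/
theorem coreSet (w : Sym2 V → ℝ) (hw0 : ∀ e, 0 ≤ w e) (hw1 : ∀ e, w e ≤ 1)
    (hm : ∑ ω, weight w ω = 1) (U : Finset V) :
    ∀ (T : Finset V), T ⊆ U → ∀ (X Y : Set V), X ⊆ ↑U → Y ⊆ ↑U →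
    ∀ (F : Set (Sym2 V) → ℝ), Monotone F → (∀ a, 0 ≤ F a) →
    (∑ ω, weight w ω * (F (⋃ t ∈ T, rC U t ω) * ind {ω | ∀ t ∈ T, ω ∈ rD U t X} ω)) *
      (∑ ω, weight w ω * ind {ω | ∀ t ∈ T, ω ∈ rD U t Y} ω) ≤
    (∑ ω, weight w ω * (F (⋃ t ∈ T, rC U t ω) * ind {ω | ∀ t ∈ T, ω ∈ rD U t (X ∩ Y)} ω)) *
      (∑ ω, weight w ω * ind {ω | ∀ t ∈ T, ω ∈ rD U t (X ∪ Y)} ω) := by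
  induction U using Finset.strongInduction with
  | H U ih =>
  intro T hTU X Y hXU hYU F hF hF0
  have hRHS : 0 ≤ (∑ ω, weight w ω * (F (⋃ t ∈ T, rC U t ω) *
      ind {ω | ∀ t ∈ T, ω ∈ rD U t (X ∩ Y)} ω)) *
      (∑ ω, weight w ω * ind {ω | ∀ t ∈ T, ω ∈ rD U t (X ∪ Y)} ω) :=
    mul_nonneg (sum_ind_nonneg hw0 hw1 (fun _ => hF0 _) _)
      (Finset.sum_nonneg fun ω _ => mul_nonneg (weight_nonneg hw0 hw1 ω) (ind_nonneg _ _))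
  -- trivial cases: a terminal in `X` or in `Y`
  by_cases hTX : ∃ t ∈ T, t ∈ X
  · obtain ⟨t, htT, htX⟩ := hTX
    have h0 : ∑ ω, weight w ω * (F (⋃ t ∈ T, rC U t ω) * ind {ω | ∀ t ∈ T, ω ∈ rD U t X} ω) = 0 :=
      Finset.sum_eq_zero fun ω _ => by
        rw [rDT_eq_empty htT htX, ind_of_not_mem (Set.notMem_empty ω)]; ring
    rw [h0, zero_mul]; exact hRHS
  by_cases hTY : ∃ t ∈ T, t ∈ Y
  · obtain ⟨t, htT, htY⟩ := hTY
    have h0 : ∑ ω, weight w ω * ind {ω | ∀ t ∈ T, ω ∈ rD U t Y} ω = 0 :=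
      Finset.sum_eq_zero fun ω _ => by
        rw [rDT_eq_empty htT htY, ind_of_not_mem (Set.notMem_empty ω)]; ring
    rw [h0, mul_zero]; exact hRHS
  simp only [not_exists, not_and] at hTX hTY
  -- `Z := X ∩ Y`
  set Z : Finset V := U.filter fun v => v ∈ X ∧ v ∈ Y with hZ
  have hZU : Z ⊆ U := Finset.filter_subset _ _
  have hmemZ : ∀ v, v ∈ Z ↔ v ∈ X ∧ v ∈ Y := fun v => by
    simp only [hZ, Finset.mem_filter, and_iff_right_iff_imp]
    exact fun h => hXU h.1
  have hTZ : ∀ t ∈ T, t ∉ Z := fun t ht h => hTX t ht ((hmemZ t).1 h).1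
  rcases Z.eq_empty_or_nonempty with hZe | hZne
  · /- `X ∩ Y = ∅`: Harris twice. -/
    have hXY : ∀ ω : Set (Sym2 V), ind {ω | ∀ t ∈ T, ω ∈ rD U t (X ∩ Y)} ω = 1 := fun ω =>
      ind_of_mem fun t _ x hx _ => by
        have : x ∈ Z := (hmemZ x).2 hx
        rw [hZe] at this
        exact absurd this (Finset.notMem_empty x)
    have hXuY : ∀ ω : Set (Sym2 V), ind {ω | ∀ t ∈ T, ω ∈ rD U t (X ∪ Y)} ω =
        ind {ω | ∀ t ∈ T, ω ∈ rD U t X} ω * ind {ω | ∀ t ∈ T, ω ∈ rD U t Y} ω := fun ω => by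
      rw [rDT_union, ind_inter]
    simp_rw [hXY, mul_one, hXuY]
    have hFm : Monotone fun ω => F (⋃ t ∈ T, rC U t ω) := fun a b hab => hF (rCT_mono U T hab)
    have h1 : ∑ ω, weight w ω * (F (⋃ t ∈ T, rC U t ω) * ind {ω | ∀ t ∈ T, ω ∈ rD U t X} ω) ≤
        (∑ ω, weight w ω * F (⋃ t ∈ T, rC U t ω)) *
          ∑ ω, weight w ω * ind {ω | ∀ t ∈ T, ω ∈ rD U t X} ω :=
      harris_mono_anti hw0 hw1 hm (fun _ => hF0 _) hFm
        (ind_rDT_antitone U T X) (fun _ => ind_le_one _ _)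
    have h4 : (∑ ω, weight w ω * ind {ω | ∀ t ∈ T, ω ∈ rD U t X} ω) *
        (∑ ω, weight w ω * ind {ω | ∀ t ∈ T, ω ∈ rD U t Y} ω) ≤
        ∑ ω, weight w ω * (ind {ω | ∀ t ∈ T, ω ∈ rD U t X} ω *
          ind {ω | ∀ t ∈ T, ω ∈ rD U t Y} ω) :=
      harris_anti_anti hw0 hw1 hm (ind_rDT_antitone U T X) (ind_rDT_antitone U T Y)
        (fun _ => ind_le_one _ _) (fun _ => ind_le_one _ _)
    have hFn : 0 ≤ ∑ ω, weight w ω * F (⋃ t ∈ T, rC U t ω) :=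
      Finset.sum_nonneg fun ω _ => mul_nonneg (weight_nonneg hw0 hw1 ω) (hF0 _)
    have hYn : 0 ≤ ∑ ω, weight w ω * ind {ω | ∀ t ∈ T, ω ∈ rD U t Y} ω :=
      Finset.sum_nonneg fun ω _ => mul_nonneg (weight_nonneg hw0 hw1 ω) (ind_nonneg _ _)
    -- `E[F·1_X]E[1_Y] ≤ E[F]E[1_X]E[1_Y] ≤ E[F]E[1_X 1_Y]`
    calc (∑ ω, weight w ω * (F (⋃ t ∈ T, rC U t ω) * ind {ω | ∀ t ∈ T, ω ∈ rD U t X} ω)) *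
          (∑ ω, weight w ω * ind {ω | ∀ t ∈ T, ω ∈ rD U t Y} ω)
        ≤ ((∑ ω, weight w ω * F (⋃ t ∈ T, rC U t ω)) *
            ∑ ω, weight w ω * ind {ω | ∀ t ∈ T, ω ∈ rD U t X} ω) *
          (∑ ω, weight w ω * ind {ω | ∀ t ∈ T, ω ∈ rD U t Y} ω) :=
          mul_le_mul_of_nonneg_right h1 hYn
      _ = (∑ ω, weight w ω * F (⋃ t ∈ T, rC U t ω)) *
          ((∑ ω, weight w ω * ind {ω | ∀ t ∈ T, ω ∈ rD U t X} ω) *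
            ∑ ω, weight w ω * ind {ω | ∀ t ∈ T, ω ∈ rD U t Y} ω) := by ring
      _ ≤ (∑ ω, weight w ω * F (⋃ t ∈ T, rC U t ω)) *
          ∑ ω, weight w ω * (ind {ω | ∀ t ∈ T, ω ∈ rD U t X} ω *
            ind {ω | ∀ t ∈ T, ω ∈ rD U t Y} ω) := mul_le_mul_of_nonneg_left h4 hFn
  · /- `Z ≠ ∅`: condition on `S` and apply the four functions theorem with the induction hypothesis on `U ∖ Z`. -/
    have hss : U \ Z ⊂ U := Finset.sdiff_ssubset hZU hZne
    have hTU' : T ⊆ U \ Z := fun t ht => Finset.mem_sdiff.2 ⟨hTU ht, hTZ t ht⟩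
    have hZX : (↑Z : Set V) ⊆ X := fun v hv => ((hmemZ v).1 hv).1
    have hZY : (↑Z : Set V) ⊆ Y := fun v hv => ((hmemZ v).1 hv).2
    have hZXY : (↑Z : Set V) ⊆ X ∩ Y := fun v hv => (hmemZ v).1 hv
    have hZXuY : (↑Z : Set V) ⊆ X ∪ Y := fun v hv => Or.inl (((hmemZ v).1 hv).1)
    -- abbreviation for the block expectations on `U ∖ Z`
    set bE : (Set (Sym2 V) → ℝ) → Set V → Set V → ℝ := fun H B S =>
      ∑ ω, weight w ω * (H (⋃ t ∈ T, rC (U \ Z) t ω) *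
        ind {ω | ∀ t ∈ T, ω ∈ rD (U \ Z) t (B ∪ S)} ω) with hbE
    have bE_nonneg : ∀ (H : Set (Sym2 V) → ℝ), (∀ a, 0 ≤ H a) → ∀ B S, 0 ≤ bE H B S :=
      fun H hH B S => sum_ind_nonneg hw0 hw1 (fun _ => hH _) _
    have e1 := step_sumSet hZU hTZ hZX w hm F
    have e2 : ∑ ω, weight w ω * ind {ω | ∀ t ∈ T, ω ∈ rD U t Y} ω =
        ∑ ζ, weight w ζ * bE (fun _ => 1) (Y \ ↑Z) (rS U Z ζ) := by
      have := step_sumSet hZU hTZ hZY w hm (fun _ => 1)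
      simp only [one_mul] at this
      simpa only [hbE, one_mul] using this
    have e3 := step_sumSet hZU hTZ hZXY w hm F
    have e4 : ∑ ω, weight w ω * ind {ω | ∀ t ∈ T, ω ∈ rD U t (X ∪ Y)} ω =
        ∑ ζ, weight w ζ * bE (fun _ => 1) ((X ∪ Y) \ ↑Z) (rS U Z ζ) := by
      have := step_sumSet hZU hTZ hZXuY w hm (fun _ => 1)
      simp only [one_mul] at this
      simpa only [hbE, one_mul] using this
    rw [e1, e2, e3, e4]
    change (∑ ζ, weight w ζ * bE F (X \ ↑Z) (rS U Z ζ)) * (∑ ζ, weight w ζ * bE (fun _ => 1) (Y \ ↑Z) (rS U Z ζ)) ≤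
      (∑ ζ, weight w ζ * bE F ((X ∩ Y) \ ↑Z) (rS U Z ζ)) *
        (∑ ζ, weight w ζ * bE (fun _ => 1) ((X ∪ Y) \ ↑Z) (rS U Z ζ))
    refine four_functions_theorem_univ
      (fun ζ => weight w ζ * bE F (X \ ↑Z) (rS U Z ζ))
      (fun ζ => weight w ζ * bE (fun _ => 1) (Y \ ↑Z) (rS U Z ζ))
      (fun ζ => weight w ζ * bE F ((X ∩ Y) \ ↑Z) (rS U Z ζ))
      (fun ζ => weight w ζ * bE (fun _ => 1) ((X ∪ Y) \ ↑Z) (rS U Z ζ))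
      (fun ζ => mul_nonneg (weight_nonneg hw0 hw1 ζ) (bE_nonneg F hF0 _ _))
      (fun ζ => mul_nonneg (weight_nonneg hw0 hw1 ζ) (bE_nonneg _ (fun _ => zero_le_one) _ _))
      (fun ζ => mul_nonneg (weight_nonneg hw0 hw1 ζ) (bE_nonneg F hF0 _ _))
      (fun ζ => mul_nonneg (weight_nonneg hw0 hw1 ζ) (bE_nonneg _ (fun _ => zero_le_one) _ _))
      fun a b => ?_
    -- the Ahlswede–Daykin hypothesis: weight lattice identity × induction hypothesis on `U ∖ Z`
    set Sa := rS U Z a with hSa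
    set Sb := rS U Z b with hSb
    have hSaU : Sa ⊆ ↑(U \ Z) := rS_subset U Z a
    have hSbU : Sb ⊆ ↑(U \ Z) := rS_subset U Z b
    have hX1 : X \ ↑Z ∪ Sa ⊆ ↑(U \ Z) := Set.union_subset
      (fun v hv => by rw [Finset.coe_sdiff]; exact ⟨hXU hv.1, hv.2⟩) hSaU
    have hY1 : Y \ ↑Z ∪ Sb ⊆ ↑(U \ Z) := Set.union_subset
      (fun v hv => by rw [Finset.coe_sdiff]; exact ⟨hYU hv.1, hv.2⟩) hSbU
    have IH := ih (U \ Z) hss T hTU' (X \ ↑Z ∪ Sa) (Y \ ↑Z ∪ Sb) hX1 hY1 F hF hF0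
    have hsub3 : (X ∩ Y) \ ↑Z ∪ rS U Z (a ∩ b) ⊆ (X \ ↑Z ∪ Sa) ∩ (Y \ ↑Z ∪ Sb) := by
      refine Set.union_subset (fun v hv => ⟨Or.inl ⟨hv.1.1, hv.2⟩, Or.inl ⟨hv.1.2, hv.2⟩⟩) ?_
      exact fun v hv =>
        ⟨Or.inr (rS_inter_subset U Z a b hv).1, Or.inr (rS_inter_subset U Z a b hv).2⟩
    have hsub4 : (X ∪ Y) \ ↑Z ∪ rS U Z (a ∪ b) ⊆ (X \ ↑Z ∪ Sa) ∪ (Y \ ↑Z ∪ Sb) := by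
      rw [rS_union]
      rintro v (⟨hXY | hXY, hvZ⟩ | hS | hS)
      · exact Or.inl (Or.inl ⟨hXY, hvZ⟩)
      · exact Or.inr (Or.inl ⟨hXY, hvZ⟩)
      · exact Or.inl (Or.inr hS)
      · exact Or.inr (Or.inr hS)
    have h3 : ∑ ω, weight w ω * (F (⋃ t ∈ T, rC (U \ Z) t ω) *
        ind {ω | ∀ t ∈ T, ω ∈ rD (U \ Z) t ((X \ ↑Z ∪ Sa) ∩ (Y \ ↑Z ∪ Sb))} ω) ≤
        bE F ((X ∩ Y) \ ↑Z) (rS U Z (a ∩ b)) :=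
      sum_ind_mono hw0 hw1 (fun _ => hF0 _) (rDT_antitone (U \ Z) T hsub3)
    have h4 : ∑ ω, weight w ω * ind {ω | ∀ t ∈ T, ω ∈ rD (U \ Z) t ((X \ ↑Z ∪ Sa) ∪ (Y \ ↑Z ∪ Sb))} ω ≤
        bE (fun _ => 1) ((X ∪ Y) \ ↑Z) (rS U Z (a ∪ b)) := by
      have := sum_ind_mono hw0 hw1 (h := fun _ => (1 : ℝ)) (fun _ => zero_le_one)
        (rDT_antitone (U \ Z) T hsub4) (w := w)
      simp only [one_mul] at this
      simpa only [hbE, one_mul] using this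
    have hn3 : 0 ≤ ∑ ω, weight w ω * (F (⋃ t ∈ T, rC (U \ Z) t ω) *
        ind {ω | ∀ t ∈ T, ω ∈ rD (U \ Z) t ((X \ ↑Z ∪ Sa) ∩ (Y \ ↑Z ∪ Sb))} ω) :=
      sum_ind_nonneg hw0 hw1 (fun _ => hF0 _) _
    have hIH' : bE F (X \ ↑Z) Sa * bE (fun _ => 1) (Y \ ↑Z) Sb ≤
        bE F ((X ∩ Y) \ ↑Z) (rS U Z (a ∩ b)) * bE (fun _ => 1) ((X ∪ Y) \ ↑Z) (rS U Z (a ∪ b)) := by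
      have hIH0 : bE F (X \ ↑Z) Sa * bE (fun _ => 1) (Y \ ↑Z) Sb ≤
          (∑ ω, weight w ω * (F (⋃ t ∈ T, rC (U \ Z) t ω) *
            ind {ω | ∀ t ∈ T, ω ∈ rD (U \ Z) t ((X \ ↑Z ∪ Sa) ∩ (Y \ ↑Z ∪ Sb))} ω)) *
          ∑ ω, weight w ω * ind {ω | ∀ t ∈ T, ω ∈ rD (U \ Z) t ((X \ ↑Z ∪ Sa) ∪ (Y \ ↑Z ∪ Sb))} ω := by
        have e : bE (fun _ => 1) (Y \ ↑Z) Sb =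
            ∑ ω, weight w ω * ind {ω | ∀ t ∈ T, ω ∈ rD (U \ Z) t (Y \ ↑Z ∪ Sb)} ω := by
          simp only [hbE, one_mul]
        rw [e]; exact IH
      exact hIH0.trans (mul_le_mul h3 h4 (Finset.sum_nonneg fun ω _ =>
        mul_nonneg (weight_nonneg hw0 hw1 ω) (ind_nonneg _ _))
        (bE_nonneg F hF0 _ _))
    have hwab := weight_inter_mul_union w a b
    show weight w a * bE F (X \ ↑Z) Sa * (weight w b * bE (fun _ => 1) (Y \ ↑Z) Sb) ≤
      weight w (a ∩ b) * bE F ((X ∩ Y) \ ↑Z) (rS U Z (a ∩ b)) *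
        (weight w (a ∪ b) * bE (fun _ => 1) ((X ∪ Y) \ ↑Z) (rS U Z (a ∪ b)))
    calc weight w a * bE F (X \ ↑Z) Sa * (weight w b * bE (fun _ => 1) (Y \ ↑Z) Sb)
        = (weight w a * weight w b) * (bE F (X \ ↑Z) Sa * bE (fun _ => 1) (Y \ ↑Z) Sb) := by ring
      _ ≤ (weight w (a ∩ b) * weight w (a ∪ b)) *
          (bE F ((X ∩ Y) \ ↑Z) (rS U Z (a ∩ b)) * bE (fun _ => 1) ((X ∪ Y) \ ↑Z) (rS U Z (a ∪ b))) := by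
          rw [hwab]
          exact mul_le_mul_of_nonneg_left hIH'
            (mul_nonneg (weight_nonneg hw0 hw1 _) (weight_nonneg hw0 hw1 _))
      _ = _ := by ring

end Summit.CriticalPhenomena.PercolationContinuityZ3.Theorems.SetSourceBHK
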